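import Summits.QuantumFields.YangMills.Theorems.ConvexGribovBodyCovarianceBoundDefs
import Summits.QuantumFields.YangMills.Theorems.ConvexGribovBodyCovarianceBoundDefsB
import Summits.QuantumFields.YangMills.Theorems.ConvexGribovBodyCovarianceBoundStubSupMeasurable
import Summits.QuantumFields.YangMills.Theorems.ConvexGribovBodyCovarianceBoundStubSinLeCos
import Summits.QuantumFields.YangMills.Theorems.ConvexGribovBodyCovarianceBoundStubModeReduction
import Summits.QuantumFields.YangMills.Theorems.ConvexGribovBodyCovarianceBoundStubProjSplit
import HarnessLib

/-!
# `CovarianceBound` reduced to its two halves: second-moment bounds for the `𝔤`- and `𝔤^⊥`-parts of the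
# gauge-fixed cosine modes (crux stmt-QuantumFields-8780, line `Sketch`, skeleton v7)

Route `QuantumFields/YangMills/ConvexGribovBody`, crux
`Summit.QuantumFields.YangMills.Theses.ConvexGribovBody.CovarianceBound` (volume-uniform bound on the
minimal-Coulomb-gauge equal-time gluon covariance of lattice Yang–Mills on `(2S+1)⁴`, every compact simple `G`,
every faithful unitary `r`, `β ≥ β₀`, `S ≥ S₀(β)`, all spatial momenta `p`).

The line `Sketch` (support slope × response window, `𝔤/𝔤^⊥` split) closed the crux modulo two Lee–Yang window
statements (`ZeroFreeWindowLie`, `ZeroFreeWindowPerp`, file `…CovarianceBoundWindowReduction`), but its composition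
consumes the windows only through Borel–Carathéodory, i.e. only through the second-moment bounds they imply. This
file states those MINIMAL inputs as route-posited statements —

* `LieModeBound`:  `∫ sup_h ‖P_𝔤 Ĉ_j(p)‖²_F dμ_β ≤ D · (2S+1)³` for `β ≥ β₀`, `S ≥ S₀(β)`, all `p`, `j`
  (the `𝔤`-half of the crux — the Gribov–Zwanziger infrared statement proper; OPEN for every non-abelian `G`);
* `PerpModeBound`: the same for the `𝔤^⊥`-part `Ĉ_j(p) − P_𝔤 Ĉ_j(p)` (trace part for `SU(N ≥ 3)`, higher harmonics
  for non-fundamental `ρ`; void when `½(ρ g − (ρ g)ᴴ) ∈ 𝔤` for all `g`, e.g. `SU(2)` fundamental, by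
  `supPerpCosSq_eq_zero_of_skew_mem`) —

and proves `covarianceBound_of_modeBounds : LieModeBound → PerpModeBound → CovarianceBound` from the landed
classical stubs of the line: minimisers / measurability / a-priori bounds (`stub_supMeasurable`), the exact mode
reduction `cov = L⁻³ Σ_j (‖Ĉ_j‖² + ‖Ŝ_j‖²)` (`stub_modeReduction`), `∫ sup‖Ŝ_j‖² ≤ 4 ∫ sup‖Ĉ_j‖²` by translation
invariance (`stub_sinLeCos`), and the orthogonal split `sup‖Ĉ_j‖² ≤ sup‖P_𝔤 Ĉ_j‖² + sup‖P_⊥ Ĉ_j‖²` (`stub_projSplit`).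
Constants: `β₀ = max β₁ β₂`, `S₀ = max S₁ S₂`, `D = 15 (D₁ + D₂)`.

The CONVERSE `CovarianceBound → LieModeBound ∧ PerpModeBound` (pointwise `sup‖P_𝔤 Ĉ_j‖², sup‖P_⊥ Ĉ_j‖² ≤ L³ sup cov`)
is the companion file `…CovarianceBoundMomentConverse`: the two statements here are not a weakening of the crux but
a SPLIT of it into two halves of the same strength. The windows remain one sufficient mechanism for the halves
(`covarianceBound_of_zeroFreeWindows`).

Design: `LieModeBound` / `PerpModeBound` are `def … : Prop` (route-posited statements, not literature facts: nothing
in print proves them for any non-abelian `G` at any `β` uniformly in the volume); the theorem is CONDITIONAL on them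
and does not close the crux. It is the glue for promoting the halves to items (`C₁ → C₂ → C`).
-/

set_option autoImplicit false

noncomputable section

namespace Summit.QuantumFields.YangMills.Cruxes.CovarianceBound.SupportWindow

open scoped BigOperators Topology Classical MeasureTheory ProbabilityTheory Matrix ComplexConjugate
open Filter Set Function TopologicalSpace MeasureTheory
open Literature.MathematicalPhysics.QuantumFieldTheory

/-! ### The two halves of the crux (route-posited statements) -/

/-- **Second-moment bound for the `𝔤`-part of the cosine modes** (route-posited, OPEN): for every compact simple
`G` and faithful unitary `r` there is `β₀` such that for `β ≥ β₀` there are `D > 0` and `S₀` with: on every torus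
`(2S+1)⁴`, `S ≥ S₀`, for every spatial momentum `p` and polarisation `j`,
`∫ sup_{h ∈ argmin coul(U,·)} ‖P_𝔤 Ĉ_j(p; U, h)‖²_F dμ_β(U) ≤ D · (2S+1)³` — the volume-uniform bound on the
`𝔤`-components of the minimal-Coulomb-gauge equal-time gluon covariance (Gribov–Zwanziger infrared finiteness;
perturbatively false, `≍ g² L` at the lowest momentum). Equivalent to the crux restricted to the `𝔤`-part
(`…MomentConverse`). -/
def LieModeBound : Prop :=
  ∀ (G : Type) [Group G] [TopologicalSpace G] [IsTopologicalGroup G] [CompactSpace G]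
    [MeasurableSpace G] [BorelSpace G], IsCompactSimpleLieGroup G → ∀ r : LatticeRep G,
    ∃ β₀ : ℝ, ∀ β : ℝ, β₀ ≤ β → ∃ D : ℝ, 0 < D ∧ ∃ S₀ : ℕ, ∀ S : ℕ, S₀ ≤ S →
      ∀ (p : Fin 3 → ZMod (2 * S + 1)) (j : Fin 3),
        ∫ U, supLieCosSq r S p j U ∂(wilson4 r β S) ≤ D * (2 * S + 1 : ℝ) ^ 3

/-- **Second-moment bound for the `𝔤^⊥`-part of the cosine modes** (route-posited, OPEN in general): as
`LieModeBound` for `sup_h ‖Ĉ_j(p) − P_𝔤 Ĉ_j(p)‖²_F`. Holds trivially (with any `D > 0`) whenever the `𝔤^⊥`-part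
vanishes at every minimiser, e.g. for the fundamental representation of `SU(2)`
(`supPerpCosSq_fundamental_two_eq_zero`); for `SU(N ≥ 3)` fundamental it concerns the zero-mode fluctuations of the
trace part `i Im tr ρ(U^h)/N`, a dimension-3 gauge-fixed composite invisible to every variation along `𝔤`. -/
def PerpModeBound : Prop :=
  ∀ (G : Type) [Group G] [TopologicalSpace G] [IsTopologicalGroup G] [CompactSpace G]
    [MeasurableSpace G] [BorelSpace G], IsCompactSimpleLieGroup G → ∀ r : LatticeRep G,
    ∃ β₀ : ℝ, ∀ β : ℝ, β₀ ≤ β → ∃ D : ℝ, 0 < D ∧ ∃ S₀ : ℕ, ∀ S : ℕ, S₀ ≤ S →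
      ∀ (p : Fin 3 → ZMod (2 * S + 1)) (j : Fin 3),
        ∫ U, supPerpCosSq r S p j U ∂(wilson4 r β S) ≤ D * (2 * S + 1 : ℝ) ^ 3

/-! ### The composition -/

/-- **`CovarianceBound` from its two halves.** If `LieModeBound` and `PerpModeBound` hold then
`Summit.QuantumFields.YangMills.Theses.ConvexGribovBody.CovarianceBound` holds, with `β₀ = max β₁ β₂`,
`S₀ = max S₁ S₂` and `D = 15 (D₁ + D₂)`. Proof: mode reduction `∫ sup cov ≤ L⁻³ Σ_j (∫ sup‖Ĉ_j‖² + ∫ sup‖Ŝ_j‖²)`,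
`∫ sup‖Ŝ_j‖² ≤ 4 ∫ sup‖Ĉ_j‖²` (`Ŝ_j(0) = 0` at `p = 0`), and the integrated orthogonal split
`∫ sup‖Ĉ_j‖² ≤ ∫ sup‖P_𝔤 Ĉ_j‖² + ∫ sup‖P_⊥ Ĉ_j‖² ≤ (D₁ + D₂) L³`; the factor `L³` cancels. -/
theorem covarianceBound_of_modeBounds :
    LieModeBound → PerpModeBound →
      Summit.QuantumFields.YangMills.Theses.ConvexGribovBody.CovarianceBound := by
  intro hLie hPerp
  have hmeas := stub_supMeasurable
  have hsin := stub_sinLeCos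
  have hred := stub_modeReduction
  have hsplit := stub_projSplit
  rw [covarianceBound_iff]
  intro G _ _ _ _ _ _ hG r
  obtain ⟨β₁, hβ₁⟩ := hLie G hG r
  obtain ⟨β₂, hβ₂⟩ := hPerp G hG r
  refine ⟨max β₁ β₂, fun β hβ => ?_⟩
  obtain ⟨D₁, hD₁, S₁, hS₁⟩ := hβ₁ β (le_trans (le_max_left _ _) hβ)
  obtain ⟨D₂, hD₂, S₂, hS₂⟩ := hβ₂ β (le_trans (le_max_right _ _) hβ)
  refine ⟨15 * (D₁ + D₂), by positivity, max S₁ S₂, fun S hS p => ?_⟩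
  have hS1 : S₁ ≤ S := le_trans (le_max_left _ _) hS
  have hS2 : S₂ ≤ S := le_trans (le_max_right _ _) hS
  -- the two moment stubs at this `(β, S, p)`
  have hLie' : ∀ j : Fin 3, ∫ U, supLieCosSq r S p j U ∂(wilson4 r β S) ≤ D₁ * (2 * S + 1 : ℝ) ^ 3 :=
    fun j => hS₁ S hS1 p j
  have hPerp' : ∀ j : Fin 3, ∫ U, supPerpCosSq r S p j U ∂(wilson4 r β S) ≤ D₂ * (2 * S + 1 : ℝ) ^ 3 :=
    fun j => hS₂ S hS2 p j
  have hL3 : (0 : ℝ) < (2 * S + 1 : ℝ) ^ 3 := by positivity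
  change ∫ U, supCov r S p U ∂(wilson4 r β S) ≤ _
  -- landed stub: minimisers, bounds, measurability
  have hM := fun j => hmeas G r S p j
  have hex : ∀ U : GaugeConfig 4 (2 * S + 1) G, ∃ h, IsCoulMin r S U h := (hM 0).1
  have hbounds : ∀ (j : Fin 3) (U : GaugeConfig 4 (2 * S + 1) G) (h : Site 4 (2 * S + 1) → G),
      (0 ≤ modeCov r S U h p ∧ modeCov r S U h p ≤ 3 * r.N * (2 * S + 1 : ℝ) ^ 3) ∧
      froSq (cosMode r S p j U h) ≤ r.N * (2 * S + 1 : ℝ) ^ 6 ∧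
      froSq (sinMode r S p j U h) ≤ r.N * (2 * S + 1 : ℝ) ^ 6 := fun j => (hM j).2.1
  have hmC : Measurable (supCov r S p) := (hM 0).2.2.1
  have hmCos : ∀ j, Measurable (supCosSq r S p j) := fun j => (hM j).2.2.2.1
  have hmSin : ∀ j, Measurable (supSinSq r S p j) := fun j => (hM j).2.2.2.2.1
  have hsupb := fun j => (hM j).2.2.2.2.2
  have hcosb : ∀ (j : Fin 3) (U : GaugeConfig 4 (2 * S + 1) G) (h : Site 4 (2 * S + 1) → G),
      IsCoulMin r S U h → froSq (cosMode r S p j U h) ≤ r.N * (2 * S + 1 : ℝ) ^ 6 :=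
    fun j U h _ => (hbounds j U h).2.1
  -- landed stub: mode reduction (A), (B)
  obtain ⟨hred1, hred0, -⟩ := hred G r β S p hex hbounds hmC hmCos hmSin
  -- landed stub: sine ≤ 4 cosine
  have hsc : ∀ j : Fin 3, ∫ U, supSinSq r S p j U ∂(wilson4 r β S) ≤
      4 * ∫ U, supCosSq r S p j U ∂(wilson4 r β S) := by
    intro j
    by_cases hp : p = 0
    · have h0 : (fun U => supSinSq r S p j U) = fun _ => (0 : ℝ) := funext fun U => hred0 hp j U
      have hnn : 0 ≤ ∫ U, supCosSq r S p j U ∂(wilson4 r β S) :=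
        integral_nonneg fun U => ((hsupb j) U).2.1.1
      calc ∫ U, supSinSq r S p j U ∂(wilson4 r β S) = 0 := by rw [h0]; simp
        _ ≤ 4 * ∫ U, supCosSq r S p j U ∂(wilson4 r β S) := by linarith
    · exact hsin G r β S p j hp hex (fun U h => ⟨(hbounds j U h).2.1, (hbounds j U h).2.2⟩)
        (hmCos j) (hmSin j)
  -- landed stub: projected split, integrated, fed with the two moment stubs
  have hcosj : ∀ j : Fin 3, ∫ U, supCosSq r S p j U ∂(wilson4 r β S) ≤
      D₁ * (2 * S + 1 : ℝ) ^ 3 + D₂ * (2 * S + 1 : ℝ) ^ 3 := by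
    intro j
    have hPj := hsplit G r S p j
    have hle : ∀ U, supCosSq r S p j U ≤ supLieCosSq r S p j U + supPerpCosSq r S p j U :=
      fun U => ((hPj.2.2.2 U (hcosb j U))).2.2.2.2
    have hbL : ∀ U, 0 ≤ supLieCosSq r S p j U ∧ supLieCosSq r S p j U ≤ r.N * (2 * S + 1 : ℝ) ^ 6 :=
      fun U => ⟨(hPj.2.2.2 U (hcosb j U)).1, (hPj.2.2.2 U (hcosb j U)).2.1⟩
    have hbP : ∀ U, 0 ≤ supPerpCosSq r S p j U ∧ supPerpCosSq r S p j U ≤ r.N * (2 * S + 1 : ℝ) ^ 6 :=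
      fun U => ⟨(hPj.2.2.2 U (hcosb j U)).2.2.1, (hPj.2.2.2 U (hcosb j U)).2.2.2.1⟩
    have hintL : Integrable (supLieCosSq r S p j) (wilson4 r β S) := by
      refine Integrable.of_bound (hPj.2.1).aestronglyMeasurable (r.N * (2 * S + 1 : ℝ) ^ 6) ?_
      exact Filter.Eventually.of_forall fun U => by
        rw [Real.norm_eq_abs, abs_of_nonneg (hbL U).1]; exact (hbL U).2
    have hintP : Integrable (supPerpCosSq r S p j) (wilson4 r β S) := by
      refine Integrable.of_bound (hPj.2.2.1).aestronglyMeasurable (r.N * (2 * S + 1 : ℝ) ^ 6) ?_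
      exact Filter.Eventually.of_forall fun U => by
        rw [Real.norm_eq_abs, abs_of_nonneg (hbP U).1]; exact (hbP U).2
    have hintC : Integrable (supCosSq r S p j) (wilson4 r β S) := by
      refine Integrable.of_bound (hmCos j).aestronglyMeasurable (r.N * (2 * S + 1 : ℝ) ^ 6) ?_
      exact Filter.Eventually.of_forall fun U => by
        rw [Real.norm_eq_abs, abs_of_nonneg ((hsupb j) U).2.1.1]; exact ((hsupb j) U).2.1.2
    have hstep : ∫ U, supCosSq r S p j U ∂(wilson4 r β S) ≤
        (∫ U, supLieCosSq r S p j U ∂(wilson4 r β S)) + ∫ U, supPerpCosSq r S p j U ∂(wilson4 r β S) := by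
      rw [← integral_add hintL hintP]
      exact integral_mono hintC (hintL.add hintP) hle
    linarith [hLie' j, hPerp' j]
  have hjsum : ∀ j : Fin 3, (∫ U, supCosSq r S p j U ∂(wilson4 r β S)) +
      ∫ U, supSinSq r S p j U ∂(wilson4 r β S) ≤
      5 * (D₁ * (2 * S + 1 : ℝ) ^ 3 + D₂ * (2 * S + 1 : ℝ) ^ 3) := by
    intro j
    have h1 := hsc j
    have h2 := hcosj j
    have hnn : 0 ≤ ∫ U, supCosSq r S p j U ∂(wilson4 r β S) :=
      integral_nonneg fun U => ((hsupb j) U).2.1.1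
    nlinarith
  have htot : ∫ U, supCov r S p U ∂(wilson4 r β S) ≤
      (1 / (2 * S + 1 : ℝ) ^ 3) * (3 * (5 * (D₁ * (2 * S + 1 : ℝ) ^ 3 + D₂ * (2 * S + 1 : ℝ) ^ 3))) := by
    refine hred1.trans ?_
    refine mul_le_mul_of_nonneg_left ?_ (by positivity)
    calc ∑ j : Fin 3, ((∫ U, supCosSq r S p j U ∂(wilson4 r β S)) +
          ∫ U, supSinSq r S p j U ∂(wilson4 r β S))
        ≤ ∑ j : Fin 3, 5 * (D₁ * (2 * S + 1 : ℝ) ^ 3 + D₂ * (2 * S + 1 : ℝ) ^ 3) :=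
          Finset.sum_le_sum fun j _ => hjsum j
      _ = 3 * (5 * (D₁ * (2 * S + 1 : ℝ) ^ 3 + D₂ * (2 * S + 1 : ℝ) ^ 3)) := by
          simp only [Finset.sum_const, Finset.card_univ, Fintype.card_fin]
          ring
  have hkey : (1 / (2 * S + 1 : ℝ) ^ 3) * (3 * (5 * (D₁ * (2 * S + 1 : ℝ) ^ 3 + D₂ * (2 * S + 1 : ℝ) ^ 3))) =
      15 * (D₁ + D₂) := by
    field_simp
    ring
  linarith [hkey, htot]

end Summit.QuantumFields.YangMills.Cruxes.CovarianceBound.SupportWindow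

end
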